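import Summits.ResolutionOfSingularities.ResolutionOfSingularities.Theorems.ValuativeLuAlphaPTorsorColengthSharp
import Summits.ResolutionOfSingularities.ResolutionOfSingularities.Theorems.ValuativeLuAlphaPTorsorExceptionalLine
import Summits.ResolutionOfSingularities.ResolutionOfSingularities.Theorems.ValuativeLuAlphaPTorsorCornerStep

/-!
# Giraud's free step in the chart of `x`: the colength of the finite part does not increase

Helper file for the stub `free_chart_colength` (F2x: Giraud 1983, §2.5, cases (A)/(B) at a point
of the `x`-chart) of the line `pfaff-line-log-final-forms` (crux `Valuative.LuAlphaPTorsor`,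
item `stmt-ResolutionOfSingularities-0641`).

Setting: `(R, 𝔪 = (x, y))` a two-dimensional regular local subring of the field `K`,
`A = R[y/x] ⊆ K` the chart of the blowing up of the closed point (`chartAdjoin`,
`ι = chartIncl x y`, `𝔪A = xA`), `Q ∋ x` a prime of `A`, `T = A_Q` and `ιT : R → T`. In the
free step of Giraud's induction `D₀` (of finite colength, `D₀ ≠ R`, of order `m ≥ 1`) is the
finite part of the log-content for the boundary `{x}`, `D₁` that for the boundary `{x, y}`, with
`y D₀ ⊆ D₁ ⊆ D₀ = D₁ + (B)`, and the content at the point `Q` of the chart has finite part `H'`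
with `𝔟 T = xʳ H'`, `𝔟 = D₁ + x D₀`. Let `H = (D₀A : xᵐ) T` be the localised weak transform
of `D₀`, so that `λ(T/H) + λ(R/𝔪ᵐ) ≤ c = λ(R/D₀)`
(`length_quotient_weakTransform_map_add_length_le`).

* case (A), `D₁ ⊆ 𝔪ᵐ⁺¹`: `𝔟 ⊆ 𝔪ᵐ⁺¹`, `r = m + 1`, `H' = (𝔟T : xᵐ⁺¹) ⊇ H` (as `𝔟 ⊇ x D₀`), so
  `λ(T/H') ≤ λ(T/H) ≤ c - λ(R/𝔪ᵐ) < c`;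
* case (B), `D₁ ⊄ 𝔪ᵐ⁺¹`: `r = m`, `H' = (𝔟T : xᵐ)`, `H ⊆ H' + (B')` with `ιT B = xᵐ B'`, and
  `(H' : B') ⊇ (x, ψ)` for the strict transform `ψ` of any `φ ∈ D₁ ∖ 𝔪ᵐ⁺¹`; the cyclic module
  `(H' + (B'))/H'` has length `≤ λ(T/(x, ψ)) ≤ m` (`exists_strictTransform_chart_length_le`), so
  `λ(T/H') ≤ λ(T/H) + m ≤ c`, with `< c` if `m ≥ 2` (`λ(R/𝔪ᵐ) ≥ m + 1`) or if some order-one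
  `φ ∈ D₁` has a strict transform `ψ ∉ Q` (then `ψ` is a unit of `T` in `H'`, `H' = T`).

References: J. Giraud, *Forme normale d'une fonction sur une surface de caractéristique
positive*, Bull. SMF 111 (1983), Lemme 2.3, §2.5; C. Huneke, I. Swanson, *Integral Closure of
Ideals, Rings, and Modules* (2006), Lemma 14.3.4.
-/

set_option linter.dupNamespace false

noncomputable section

open IsLocalRing Literature.AlgebraicGeometry.Resolution

namespace Summit.ResolutionOfSingularities.ResolutionOfSingularities.Theorems.PfaffLine

section Abstract

/-- In a commutative ring: `λ(T/N) ≤ λ(T/(N + (b))) + λ(T/I)` whenever `I b ⊆ N` — the kernel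
`(N + (b))/N` of `T/N → T/(N + (b))` is the cyclic module generated by the class of `b`, a
quotient of `T/I` (adapted from `length_quotient_span_pair_mul_le`). [folklore] -/
theorem length_quotient_le_length_quotient_sup_add {T : Type*} [CommRing T] (N I : Ideal T)
    (b : T) (hI : ∀ i ∈ I, i * b ∈ N) :
    Module.length T (T ⧸ N) ≤
      Module.length T (T ⧸ (N ⊔ Ideal.span {b})) + Module.length T (T ⧸ I) := by
  have hle : N ≤ N ⊔ Ideal.span {b} := le_sup_left
  -- `λ(T/N) = λ(ker (T/N → T/(N + (b)))) + λ(T/(N + (b)))`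
  have hexact := Module.length_eq_add_of_exact (LinearMap.ker (Submodule.factor hle)).subtype
    (Submodule.factor hle) (Submodule.injective_subtype _) (Submodule.factor_surjective hle)
    (LinearMap.exact_subtype_ker_map _)
  -- `g₀ : T → T/N`, `t ↦ [b t]`, kills `I`, and its range contains the kernel
  let g₀ : T →ₗ[T] T ⧸ N := (Submodule.mkQ N).comp (LinearMap.mulLeft T b)
  have hg₀ : ∀ t, g₀ t = Submodule.Quotient.mk (b * t) := fun t => rfl
  have hkerg : I ≤ LinearMap.ker g₀ := by
    intro t ht
    rw [LinearMap.mem_ker, hg₀, Submodule.Quotient.mk_eq_zero, mul_comm]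
    exact hI t ht
  set g := Submodule.liftQ I g₀ hkerg with hg
  have hrange : LinearMap.ker (Submodule.factor hle) ≤ LinearMap.range g := by
    rw [hg, Submodule.range_liftQ]
    intro z hz
    obtain ⟨t, rfl⟩ := Submodule.mkQ_surjective _ z
    have hz' : (Submodule.Quotient.mk t : T ⧸ (N ⊔ Ideal.span {b})) = 0 := hz
    rw [Submodule.Quotient.mk_eq_zero] at hz'
    obtain ⟨n, hn, e, he, hne⟩ := Submodule.mem_sup.mp hz'
    obtain ⟨d, rfl⟩ := Ideal.mem_span_singleton'.mp he
    refine ⟨d, ?_⟩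
    rw [hg₀, Submodule.mkQ_apply, eq_comm, Submodule.Quotient.eq, ← hne]
    have e : n + d * b - b * d = n := by ring
    rw [e]
    exact hn
  calc Module.length T (T ⧸ N)
      = Module.length T (LinearMap.ker (Submodule.factor hle)) +
          Module.length T (T ⧸ (N ⊔ Ideal.span {b})) := hexact
    _ ≤ Module.length T (T ⧸ I) + Module.length T (T ⧸ (N ⊔ Ideal.span {b})) := by
        refine add_le_add ?_ le_rfl
        calc Module.length T (LinearMap.ker (Submodule.factor hle))
            ≤ Module.length T (LinearMap.range g) :=
              Module.length_le_of_injective (Submodule.inclusion hrange)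
                (Submodule.inclusion_injective hrange)
          _ ≤ Module.length T (T ⧸ I) :=
              Module.length_le_of_surjective g.rangeRestrict g.surjective_rangeRestrict
    _ = _ := add_comm _ _

/-- `ℕ∞` bookkeeping: `d ≤ a + m`, `m + 1 ≤ b`, `a + b ≤ c < ⊤` give `d < c`. [folklore] -/
theorem lt_of_le_add_freeColength {a b c d m : ℕ∞} (hd : d ≤ a + m) (hb : m + 1 ≤ b)
    (h : a + b ≤ c) (hc : c ≠ ⊤) : d < c := by
  rw [← ENat.add_one_le_iff' hc]
  calc d + 1 ≤ a + m + 1 := add_le_add hd le_rfl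
    _ = a + (m + 1) := add_assoc a m 1
    _ ≤ a + b := add_le_add le_rfl hb
    _ ≤ c := h

end Abstract

open IsLocalRing

/-- **F2x — Giraud 1983, §2.5, cases (A)/(B) at a point of the `x`-chart.** For a
two-dimensional regular local ring `(R, 𝔪 = (x, y))` of `K`, ideals `y D₀ ⊆ D₁ ⊆ D₀ = D₁ + (B)`
with `D₀ ≠ R` of finite colength, a prime `Q ∋ x` of `A = R[y/x]` and `T = A_Q`: the ideal
`𝔟 = D₁ + x D₀` has `𝔟 T = xʳ H'` with `H'` of finite colength `λ(T/H') ≤ λ(R/D₀)`, and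
`λ(T/H') < λ(R/D₀)` unless `D₁` has order one and every order-one element of `D₁` has its
strict transform in `Q`. With `m = ord D₀` and `H` the localised weak transform of `D₀`
(`λ(T/H) + λ(R/𝔪ᵐ) ≤ λ(R/D₀)`): if `D₁ ⊆ 𝔪ᵐ⁺¹` take `r = m + 1`, `H' = (𝔟T : xᵐ⁺¹) ⊇ H`;
otherwise `r = m`, `H' = (𝔟T : xᵐ)`, `H ⊆ H' + (B')` (`ιT B = xᵐ B'`), `(H' : B') ⊇ (x, ψ)` for
the strict transform `ψ` of `φ ∈ D₁ ∖ 𝔪ᵐ⁺¹`, and `λ(T/(x, ψ)) ≤ m ≤ λ(R/𝔪ᵐ)`. [folklore] -/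
theorem free_chart_colength : ∀ {K : Type} [Field K] {R : Subring K} [IsRegularLocalRing R] {x y : R}, ringKrullDim R = 2 → maximalIdeal R = Ideal.span {x, y} → x ≠ 0 → ∀ (D₁ D₀ : Ideal R) (B : R), D₁ ≤ D₀ → Ideal.span {y} * D₀ ≤ D₁ → D₀ = D₁ ⊔ Ideal.span {B} → IsFiniteLength R (R ⧸ D₀) → D₀ ≠ ⊤ → ∀ (Q : Ideal (Literature.AlgebraicGeometry.Resolution.chartAdjoin (K := K) x y)) [Q.IsPrime], Literature.AlgebraicGeometry.Resolution.chartIncl x y x ∈ Q → ∃ (r : ℕ) (H' : Ideal (LocalSubring.ofPrime (Literature.AlgebraicGeometry.Resolution.chartAdjoin (K := K) x y) Q).toSubring), (D₁ ⊔ Ideal.span {x} * D₀).map ((algebraMap (Literature.AlgebraicGeometry.Resolution.chartAdjoin (K := K) x y) (LocalSubring.ofPrime (Literature.AlgebraicGeometry.Resolution.chartAdjoin (K := K) x y) Q).toSubring).comp (Literature.AlgebraicGeometry.Resolution.chartIncl x y)) = Ideal.span {((algebraMap (Literature.AlgebraicGeometry.Resolution.chartAdjoin (K := K) x y) (LocalSubring.ofPrime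 (Literature.AlgebraicGeometry.Resolution.chartAdjoin (K := K) x y) Q).toSubring).comp (Literature.AlgebraicGeometry.Resolution.chartIncl x y)) x ^ r} * H' ∧ IsFiniteLength (LocalSubring.ofPrime (Literature.AlgebraicGeometry.Resolution.chartAdjoin (K := K) x y) Q).toSubring ((LocalSubring.ofPrime (Literature.AlgebraicGeometry.Resolution.chartAdjoin (K := K) x y) Q).toSubring ⧸ H') ∧ Module.length (LocalSubring.ofPrime (Literature.AlgebraicGeometry.Resolution.chartAdjoin (K := K) x y) Q).toSubring ((LocalSubring.ofPrime (Literature.AlgebraicGeometry.Resolution.chartAdjoin (K := K) x y) Q).toSubring ⧸ H') ≤ Module.length R (R ⧸ D₀) ∧ (Module.length (LocalSubring.ofPrime (Literature.AlgebraicGeometry.Resolution.chartAdjoin (K := K) x y) Q).toSubring ((LocalSubring.ofPrime (Literature.AlgebraicGeometry.Resolution.chartAdjoin (K := K) x y) Q).toSubring ⧸ H') < Module.length R (R ⧸ D₀) ∨ ((∃ φ ∈ D₁, φ ∉ maximalIdeal R ^ 2) ∧ ∀ φ ∈ D₁, φ ∉ maximalIdeal R ^ 2 → ∀ ψ : Literature.AlgebraicGeometry.Resolution.chartAdjoin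 (K := K) x y, Literature.AlgebraicGeometry.Resolution.chartIncl x y φ = Literature.AlgebraicGeometry.Resolution.chartIncl x y x * ψ → ψ ∈ Q)) := by
  intro K _ R _ x y hdim hm hx0 D₁ D₀ B h10 _ hD0 hfin htop Q _ hxQ
  -- `T = A_Q`, `aT : A → T`, `g = ιT : R → T` (no `set` for `A`: `Q` depends on it)
  set T : Subring K := (LocalSubring.ofPrime (chartAdjoin (K := K) x y) Q).toSubring
  set aT : chartAdjoin (K := K) x y →+* T := algebraMap (chartAdjoin (K := K) x y) T
  set g : R →+* T := aT.comp (chartIncl x y) with hgdef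
  have hx0K : ((x : R) : K) ≠ 0 := fun e => hx0 (Subtype.ext e)
  have hgK : ∀ a : R, ((g a : T) : K) = ((a : R) : K) := fun a => rfl
  have hx' : g x ≠ 0 := by
    intro h0
    apply hx0K
    rw [← hgK x, h0, ZeroMemClass.coe_zero]
  have hxm : x ∈ maximalIdeal R := hm ▸ Ideal.subset_span (by simp)
  -- `J ⊆ 𝔪ʳ ⇒ J T ⊆ xʳ T`
  have hmaple : ∀ {J : Ideal R} {r : ℕ}, J ≤ maximalIdeal R ^ r →
      J.map g ≤ Ideal.span {g x ^ r} := by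
    intro J r hJ
    rw [hgdef, ← Ideal.map_map]
    refine (Ideal.map_mono (map_chartIncl_le_span_pow hm hx0 hJ)).trans ?_
    rw [Ideal.map_span, Set.image_singleton, map_pow, RingHom.comp_apply]
  have hlen_anti : ∀ {N N' : Ideal T}, N ≤ N' →
      Module.length T (T ⧸ N') ≤ Module.length T (T ⧸ N) := fun h =>
    Module.length_le_of_surjective (Submodule.factor h) (Submodule.factor_surjective h)
  -- the order `m ≥ 1` of `D₀`, the localised weak transform `H`, and the sharp drop (V3, V4)
  obtain ⟨m, hm1, hD0m, hD0m1⟩ :=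
    exists_order_cornerStep htop (ne_bot_of_isFiniteLength_quotient_cornerStep hdim hfin)
  set H : Ideal T := (weakTransformChart x y D₀ m).map aT with hHdef
  have hV3 : Module.length T (T ⧸ H) + Module.length R (R ⧸ maximalIdeal R ^ m) ≤
      Module.length R (R ⧸ D₀) :=
    length_quotient_weakTransform_map_add_length_le hdim hm hx0 hm1 hD0m hD0m1 hfin Q
  have hD0map : D₀.map g = Ideal.span {g x ^ m} * H := by
    rw [hHdef, hgdef, ← Ideal.map_map, map_eq_span_pow_mul_weakTransform hm hx0 hD0m,
      Ideal.map_mul, Ideal.map_span, Set.image_singleton, map_pow, RingHom.comp_apply]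
  have hc : Module.length R (R ⧸ D₀) ≠ ⊤ := Module.length_ne_top_iff.mpr hfin
  have hV4 := length_quotient_pow_maximalIdeal_ge hdim
  have hmb : (m : ℕ∞) ≤ Module.length R (R ⧸ maximalIdeal R ^ m) := by
    rcases Nat.lt_or_ge m 2 with h2 | h2
    · obtain rfl : m = 1 := by omega
      rw [hV4.1, Nat.cast_one]
    · exact le_trans (by exact_mod_cast Nat.le_succ m) (hV4.2 m h2)
  -- `𝔟 = D₁ + x D₀`
  have hbD1 : D₁.map g ≤ (D₁ ⊔ Ideal.span {x} * D₀).map g := Ideal.map_mono le_sup_left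
  have hbx : (Ideal.span {x} * D₀).map g ≤ (D₁ ⊔ Ideal.span {x} * D₀).map g :=
    Ideal.map_mono le_sup_right
  by_cases hcase : D₁ ≤ maximalIdeal R ^ (m + 1)
  · -- case (A): `𝔟 ⊆ 𝔪ᵐ⁺¹`, `r = m + 1`, `H ⊆ H' = (𝔟T : xᵐ⁺¹)`
    have hb : D₁ ⊔ Ideal.span {x} * D₀ ≤ maximalIdeal R ^ (m + 1) := by
      refine sup_le hcase ?_
      rw [pow_succ']
      exact Ideal.mul_mono ((Ideal.span_singleton_le_iff_mem _).mpr hxm) hD0m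
    refine ⟨m + 1, ((D₁ ⊔ Ideal.span {x} * D₀).map g).colon {g x ^ (m + 1)},
      eq_span_singleton_mul_colon (hmaple hb), ?_⟩
    have hHH' : H ≤ ((D₁ ⊔ Ideal.span {x} * D₀).map g).colon {g x ^ (m + 1)} := by
      intro h hh
      have e : h * g x ^ (m + 1) = g x * (g x ^ m * h) := by ring
      rw [Submodule.mem_colon_singleton, smul_eq_mul, e]
      refine hbx ?_
      rw [Ideal.map_mul, Ideal.map_span, Set.image_singleton, hD0map]
      exact Ideal.mul_mem_mul (Ideal.mem_span_singleton_self _)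
        (Ideal.mul_mem_mul (Ideal.mem_span_singleton_self _) hh)
    have h1b : (0 : ℕ∞) + 1 ≤ Module.length R (R ⧸ maximalIdeal R ^ m) := by
      rw [zero_add]
      exact le_trans (by exact_mod_cast hm1) hmb
    have hlt := lt_of_le_add_freeColength ((hlen_anti hHH').trans (add_zero _).ge) h1b hV3 hc
    exact ⟨Module.length_ne_top_iff.mp (ne_top_of_lt hlt), hlt.le, Or.inl hlt⟩
  · -- case (B): `ord D₁ = m`, `r = m`, `H' = (𝔟T : xᵐ)`, `H ⊆ H' + (B')`, `(H' : B') ⊇ (x, ψ)`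
    obtain ⟨φ, hφD1, hφm1⟩ := SetLike.not_le_iff_exists.mp hcase
    have hφm : φ ∈ maximalIdeal R ^ m := hD0m (h10 hφD1)
    obtain ⟨ψ, hψ, hV5⟩ := exists_strictTransform_chart_length_le hdim hm hx0 φ m hφm hφm1
    have h5 : Module.length T (T ⧸ Ideal.span {g x, aT ψ}) ≤ (m : ℕ∞) := hV5 Q hxQ
    have hb : D₁ ⊔ Ideal.span {x} * D₀ ≤ maximalIdeal R ^ m :=
      sup_le (h10.trans hD0m) (Ideal.mul_le_left.trans hD0m)
    set H' : Ideal T := ((D₁ ⊔ Ideal.span {x} * D₀).map g).colon {g x ^ m} with hH'def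
    have hfact : (D₁ ⊔ Ideal.span {x} * D₀).map g = Ideal.span {g x ^ m} * H' :=
      eq_span_singleton_mul_colon (hmaple hb)
    have hmemH' : ∀ t : T, g x ^ m * t ∈ (D₁ ⊔ Ideal.span {x} * D₀).map g → t ∈ H' :=
      fun t ht => by rwa [hH'def, Submodule.mem_colon_singleton, smul_eq_mul, mul_comm t]
    -- `B'` with `ιT B = xᵐ B'`, and the strict transform `ψ` of `φ`: `ιT φ = xᵐ ψ`
    have hBD0 : B ∈ D₀ := by
      rw [hD0]
      exact Submodule.mem_sup_right (Ideal.mem_span_singleton_self B)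
    obtain ⟨B', hB'⟩ :=
      Ideal.mem_span_singleton'.mp (hmaple hD0m (Ideal.mem_map_of_mem g hBD0))
    have hψT : g φ = g x ^ m * aT ψ := by
      simp only [hgdef, RingHom.comp_apply, hψ, map_mul, map_pow]
    have hψH' : aT ψ ∈ H' :=
      hmemH' _ (hψT ▸ hbD1 (Ideal.mem_map_of_mem g hφD1))
    have hxB' : g x * B' ∈ H' := by
      refine hmemH' _ ?_
      have e : g x ^ m * (g x * B') = g (x * B) := by rw [map_mul, ← hB']; ring
      rw [e]
      exact hbx (Ideal.mem_map_of_mem g (Ideal.mul_mem_mul (Ideal.mem_span_singleton_self x) hBD0))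
    have hkill : ∀ i ∈ Ideal.span {g x, aT ψ}, i * B' ∈ H' := by
      intro i hi
      obtain ⟨a, b, rfl⟩ := Ideal.mem_span_pair.mp hi
      have e : (a * g x + b * aT ψ) * B' =
          a * (g x * B') + b * B' * aT ψ := by ring
      rw [e]
      exact add_mem (Ideal.mul_mem_left _ _ hxB') (Ideal.mul_mem_left _ _ hψH')
    -- `H ⊆ H' + (B')`
    have hHle : H ≤ H' ⊔ Ideal.span {B'} := by
      intro h hh
      have h1 : g x ^ m * h ∈ D₀.map g := by
        rw [hD0map]
        exact Ideal.mul_mem_mul (Ideal.mem_span_singleton_self _) hh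
      rw [hD0, Ideal.map_sup, Ideal.map_span, Set.image_singleton] at h1
      obtain ⟨d, hd, e, he, hde⟩ := Submodule.mem_sup.mp h1
      obtain ⟨c, rfl⟩ := Ideal.mem_span_singleton'.mp he
      have hd' : d ∈ Ideal.span {g x ^ m} * H' := hfact ▸ hbD1 hd
      obtain ⟨h', hh', rfl⟩ := Ideal.mem_span_singleton_mul.mp hd'
      have e2 : h = h' + c * B' := by
        refine mul_left_cancel₀ (pow_ne_zero m hx') ?_
        rw [← hde, ← hB']
        ring
      rw [e2]
      exact add_mem (Submodule.mem_sup_left hh')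
        (Submodule.mem_sup_right (Ideal.mem_span_singleton'.mpr ⟨c, rfl⟩))
    -- lengths
    have hbound : Module.length T (T ⧸ H') ≤ Module.length T (T ⧸ H) + m :=
      calc Module.length T (T ⧸ H')
          ≤ Module.length T (T ⧸ (H' ⊔ Ideal.span {B'})) +
              Module.length T (T ⧸ Ideal.span {g x, aT ψ}) :=
            length_quotient_le_length_quotient_sup_add H' _ B' hkill
        _ ≤ Module.length T (T ⧸ H) + m := add_le_add (hlen_anti hHle) h5
    have hle : Module.length T (T ⧸ H') ≤ Module.length R (R ⧸ D₀) :=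
      hbound.trans ((add_le_add le_rfl hmb).trans hV3)
    refine ⟨m, H', hfact, Module.length_ne_top_iff.mp (ne_top_of_le_ne_top hc hle), hle, ?_⟩
    by_cases hall : ∀ φ ∈ D₁, φ ∉ maximalIdeal R ^ 2 →
        ∀ ψ : chartAdjoin (K := K) x y, chartIncl x y φ = chartIncl x y x * ψ → ψ ∈ Q
    · rcases Nat.lt_or_ge m 2 with h2 | h2
      · obtain rfl : m = 1 := by omega
        exact Or.inr ⟨⟨φ, hφD1, hφm1⟩, hall⟩
      · exact Or.inl (lt_of_le_add_freeColength hbound (by exact_mod_cast hV4.2 m h2) hV3 hc)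
    · -- an order-one `φ' ∈ D₁` with strict transform `ψ' ∉ Q`: `ψ'` is a unit of `T` in `H'`
      left
      push Not at hall
      obtain ⟨φ', hφ'D1, hφ'2, ψ', hψ', hψ'Q⟩ := hall
      obtain rfl : m = 1 := by
        by_contra hne
        exact hφ'2 (Ideal.pow_le_pow_right (show 2 ≤ m by omega) (hD0m (h10 hφ'D1)))
      have hψ'H' : aT ψ' ∈ H' := by
        refine hmemH' _ (hbD1 ?_)
        have e : g x ^ 1 * aT ψ' = g φ' := by
          simp only [pow_one, hgdef, RingHom.comp_apply, hψ', map_mul]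
        rw [e]
        exact Ideal.mem_map_of_mem g hφ'D1
      have htop' : H' = ⊤ := Ideal.eq_top_of_isUnit_mem _ hψ'H'
        (IsLocalization.map_units T (⟨ψ', hψ'Q⟩ : Q.primeCompl))
      have h0 : Module.length T (T ⧸ H') = 0 :=
        Module.length_eq_zero_iff.mpr (Ideal.Quotient.subsingleton_iff.mpr htop')
      rw [h0]
      exact Module.length_pos_iff.mpr (Ideal.Quotient.nontrivial_iff.mpr htop)

end Summit.ResolutionOfSingularities.ResolutionOfSingularities.Theorems.PfaffLine

end
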